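import Literature.MathematicalPhysics.QuantumLattice.LiebRobinsonHastingsKomaSpectralProofs

/-!
# Route `AnisotropyChord` / H0 rotor rung: LEMMA L1 of THEOREM TWIST-IR — the FILTERED LOCALITY IDENTITY
# (gap-free Hastings–Koma filtered spectral identity), PROVED

Theory seat `hubbard-h0-rotor-theory-1`, cycle 8, memo ROTOR-THEORY-8 §107, typed as
`Stiffness.FilteredLocalityIdentity` (`AnisotropyChordStiffnessDefs`): let `Hψ = E₀ψ` and suppose every
eigenvector `vᵢ` of `H` seen by BOTH the `Bψ`- and the `Aψ`-overlap has `λᵢ ≥ E₀` (a SECTOR ground state and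
sector-preserving `A, B`; no global ground state, no gap).  If `g(ω) = ∫ w(t) e^{itω} dt` with `w ∈ L¹(ℝ)` and
`g` vanishes on `(−∞, 0]`, then the `g`-filtered cross spectral weight is a time integral of the commutator
function:

  `Σᵢ g(λᵢ − E₀) ⟨ψ, A vᵢ⟩⟨vᵢ, Bψ⟩ = ∫ w(t) ⟨ψ, [A, τ_t(B)] ψ⟩ dt`.

Proof: expand `⟨ψ, [A, τ_t(B)]ψ⟩` in the eigenbasis (`commutator_expect_eq_sum`, the tree's Hastings–Koma
spectral step), exchange the finite sum with the integral (`w · e^{itω}` is integrable), and note that the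
`b`-terms integrate to `bᵢ g(E₀ − λᵢ) = 0`.  Hastings–Koma, CMP 265 (2006) §3; Nachtergaele–Sims, CMP 265
(2006) §3.2.  This file is Mathlib/Literature-only (no route vocabulary); the named statement is discharged in
the stiffness layer.
-/

set_option linter.dupNamespace false

noncomputable section

open Matrix Complex Finset MeasureTheory
open scoped ComplexConjugate
open Literature.MathematicalPhysics.QuantumLattice

namespace Summit.HubbardSuperconductivity.HubbardSuperconductivity.Theorems.AnisotropyChord.Stiffness

variable {n : Type*} [Fintype n] [DecidableEq n]

/-- `t ↦ w(t) e^{itω}` is integrable for `w ∈ L¹`. [folklore] -/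
theorem integrable_mul_cexp {w : ℝ → ℂ} (hw : Integrable w) (ω : ℝ) :
    Integrable (fun t : ℝ => w t * cexp (((t * ω : ℝ) : ℂ) * I)) := by
  refine hw.mul_bdd (c := 1) ?_ ?_
  · exact Continuous.aestronglyMeasurable (by fun_prop)
  · exact Filter.Eventually.of_forall fun t => by rw [Complex.norm_exp_ofReal_mul_I]

/-- **LEMMA L1 — the filtered locality identity (gap-free Hastings–Koma filtered spectral identity), PROVED.**
For `Hψ = E₀ψ`, `(vᵢ, λᵢ)` the eigenbasis of the Hermitian `H`, cross weights
`aᵢ = ⟨ψ, A vᵢ⟩⟨vᵢ, Bψ⟩`, `bᵢ = ⟨ψ, B vᵢ⟩⟨vᵢ, Aψ⟩` with `bᵢ ≠ 0 ⇒ E₀ ≤ λᵢ`, an integrable window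
`w` and `g(ω) = ∫ w(t)e^{itω}dt` vanishing on `ω ≤ 0`:
`Σᵢ g(λᵢ − E₀) aᵢ = ∫ w(t) ⟨ψ, [A, τ_t(B)]ψ⟩ dt`.  Theory seat memo ROTOR-THEORY-8 §107 (L1).
[cite: HastingsKomaCMP2006, §3] -/
theorem filteredLocality_identity (H : Matrix n n ℂ) (hH : H.IsHermitian) (A B : Matrix n n ℂ)
    (ψ : n → ℂ) (E₀ : ℝ) (hψ : H *ᵥ ψ = (E₀ : ℂ) • ψ)
    (hsec : ∀ i, (star ψ ⬝ᵥ (B *ᵥ ⇑(hH.eigenvectorBasis i))) *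
        (star (⇑(hH.eigenvectorBasis i)) ⬝ᵥ (A *ᵥ ψ)) ≠ 0 → E₀ ≤ hH.eigenvalues i)
    (w : ℝ → ℂ) (hw : Integrable w) (g : ℝ → ℂ)
    (hg : ∀ ω : ℝ, g ω = ∫ t : ℝ, w t * cexp (((t * ω : ℝ) : ℂ) * I))
    (hg0 : ∀ ω : ℝ, ω ≤ 0 → g ω = 0) :
    ∑ i, g (hH.eigenvalues i - E₀) *
        ((star ψ ⬝ᵥ (A *ᵥ ⇑(hH.eigenvectorBasis i))) *
          (star (⇑(hH.eigenvectorBasis i)) ⬝ᵥ (B *ᵥ ψ)))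
      = ∫ t : ℝ, w t *
          (star ψ ⬝ᵥ ((A * heisenbergEvolution H t B - heisenbergEvolution H t B * A) *ᵥ ψ)) := by
  -- cross weights
  set a : n → ℂ := fun i => (star ψ ⬝ᵥ (A *ᵥ ⇑(hH.eigenvectorBasis i))) *
    (star (⇑(hH.eigenvectorBasis i)) ⬝ᵥ (B *ᵥ ψ)) with ha
  set b : n → ℂ := fun i => (star ψ ⬝ᵥ (B *ᵥ ⇑(hH.eigenvectorBasis i))) *
    (star (⇑(hH.eigenvectorBasis i)) ⬝ᵥ (A *ᵥ ψ)) with hb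
  -- the integrand in the eigenbasis
  have hint : (fun t : ℝ => w t *
      (star ψ ⬝ᵥ ((A * heisenbergEvolution H t B - heisenbergEvolution H t B * A) *ᵥ ψ)))
      = fun t : ℝ => ∑ i, (a i * (w t * cexp (((t * (hH.eigenvalues i - E₀) : ℝ) : ℂ) * I))
          - b i * (w t * cexp (((t * (-(hH.eigenvalues i - E₀)) : ℝ) : ℂ) * I))) := by
    funext t
    rw [commutator_expect_eq_sum hH A B hψ t, Finset.mul_sum]
    refine Finset.sum_congr rfl fun i _ => ?_
    have e : -((t * (hH.eigenvalues i - E₀) : ℝ) : ℂ) * I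
        = ((t * (-(hH.eigenvalues i - E₀)) : ℝ) : ℂ) * I := by
      push_cast; ring
    rw [e, ha, hb]
    ring
  have hF : ∀ i ∈ (Finset.univ : Finset n), Integrable (fun t : ℝ =>
      a i * (w t * cexp (((t * (hH.eigenvalues i - E₀) : ℝ) : ℂ) * I))
        - b i * (w t * cexp (((t * (-(hH.eigenvalues i - E₀)) : ℝ) : ℂ) * I))) := fun i _ =>
    ((integrable_mul_cexp hw _).const_mul (a i)).sub ((integrable_mul_cexp hw _).const_mul (b i))
  have hswap := integral_finsetSum (μ := volume) Finset.univ hF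
  rw [hint]
  symm
  refine hswap.trans ?_
  -- each term
  have hi : ∀ i, ∫ t : ℝ, (a i * (w t * cexp (((t * (hH.eigenvalues i - E₀) : ℝ) : ℂ) * I))
      - b i * (w t * cexp (((t * (-(hH.eigenvalues i - E₀)) : ℝ) : ℂ) * I)))
      = a i * g (hH.eigenvalues i - E₀) - b i * g (-(hH.eigenvalues i - E₀)) := by
    intro i
    rw [integral_sub (((integrable_mul_cexp hw _).const_mul (a i)))
      (((integrable_mul_cexp hw _).const_mul (b i))), integral_const_mul, integral_const_mul, ← hg, ← hg]
  -- the `b`-terms vanish: `bᵢ ≠ 0 ⇒ λᵢ ≥ E₀ ⇒ g(E₀ − λᵢ) = 0`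
  have hbz : ∀ i, b i * g (-(hH.eigenvalues i - E₀)) = 0 := by
    intro i
    by_cases h0 : b i = 0
    · rw [h0, zero_mul]
    · have hle : E₀ ≤ hH.eigenvalues i := hsec i h0
      rw [hg0 _ (by linarith), mul_zero]
  refine Finset.sum_congr rfl fun i _ => ?_
  rw [hi i, hbz i, sub_zero, ha]
  ring

end Summit.HubbardSuperconductivity.HubbardSuperconductivity.Theorems.AnisotropyChord.Stiffness
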